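import Summits.KontsevichZagierPeriods.Zeta5Search.Barrier.ConeGammaCritFar
import Summits.KontsevichZagierPeriods.Zeta5Search.Barrier.ConeGammaCritBoxRoot
import Summits.KontsevichZagierPeriods.Zeta5Search.Barrier.ConeGammaCritCubic

/-!
# ζ(5) search — BARRIER: THE FAR CRITICAL POINT THROUGH INFINITY — soundness I (the cubic at a rational point, the
# reversed cubic and its sign at the endpoints, the zero between them, the stratum is not `Regular`)

HONEST FRAMING (cell `pub-zeta5`): systematic search; no irrationality claim unless kernel-certified. Real polynomial
algebra and affine-arithmetic membership lemmas for the checker `ConeGammaCritFar` about BZ's §5 critical system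
(MODEL objects under BZ (28)+(30), [BZ22] = arXiv:2210.03391); nothing about any γ of record, the cone's supremum (C2
OPEN), S-E (CONJECTURED) or `ζ(5)`. Theory seat cert-2 g38.

* `cubicC` = P2 g23's resolvent cubic in product form (the `hC` expression of `ConeGammaCritCubic` with `s := t`),
  `cubicC_eq_poly` (its monomial form with the Newton coefficients `cubicLead … coefA0`), `revC z = cubicLead + coefA2 z +
  coefA1 z² + coefA0 z³` (`= z³·C(1/z)`, `revC_eq`);
* `cubicAtPoly_eval` — the checker's integer polynomial IS `(Q·y_D)⁷·C(y_N/y_D)` at every box point;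
* `revC_sign_of_endSign` — a certified endpoint sign is the sign of `revC` at `z = z_N/z_den`;
* `exists_revC_zero` — opposite certified signs ⇒ a zero of `revC` strictly between the endpoints (IVT);
* `not_regular_of_cubicLead_eq_zero` — **on the stratum `{a₃ = 0}` the direction is NOT `Regular`** (≤ 2 critical
  values: the cubic degenerates to a non-zero quadratic, `cubic_at_s1_neg`), hence under `Regular` the zero `z₁` of
  `revC` is non-zero and `Y₁ = 1/z₁` is a root of `C` (`root_of_revC_zero`);
* (the `X`-identity at the far root and the far value membership are in `ConeGammaCritFarValue`).
-/

noncomputable section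

open Set

namespace Summit.KontsevichZagierPeriods.Zeta5Search.Barrier.ConeGamma

namespace CritFar

open Literature.Analysis.ValidatedNumerics (AForm)
open Literature.Analysis.ValidatedNumerics.AForm
open LemmaFBox (SC SC_pos)
open CritBox

/-! ### The resolvent cubic as a function of `(t, Y)`; Newton coefficients; the reversed cubic -/

/-- `P(Y) = (Y−t₁)(Y−t₂)(Y−t₇)` (P2 g23's `hP`). -/
def cubicP (t : Fin 8 → ℝ) (Y : ℝ) : ℝ := (Y - t 1) * (Y - t 2) * (Y - t 7)

/-- `Q(Y) = (Y+t₆)((t₁+t₂+t₇−Y)(t₀−Y)) − P(Y)` (P2 g23's `hQ`; a QUADRATIC in `Y`: the cubic terms cancel). -/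
def cubicQ (t : Fin 8 → ℝ) (Y : ℝ) : ℝ := (Y + t 6) * ((t 1 + t 2 + t 7 - Y) * (t 0 - Y)) - cubicP t Y

/-- P2 g23's resolvent cubic `C(Y)` in its product form (the `hC` expression of `ConeGammaCritCubic`, `s := t`). -/
def cubicC (t : Fin 8 → ℝ) (Y : ℝ) : ℝ :=
  -((Y + t 3) * (Y + t 4) * (Y + t 6) * (Y + t 5)) * (t 1 + t 2 + t 7 - Y) ^ 2 * (t 0 - Y)
    + (2 * Y ^ 3 - 2 * (t 0 - (t 3 + t 4 + t 6 + t 5)) * Y ^ 2 - (t 0 * (t 3 + t 4 + t 6 + t 5)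
        - (t 3 * t 4 + t 3 * t 6 + t 3 * t 5 + t 4 * t 6 + t 4 * t 5 + t 6 * t 5)) * Y
        - (t 0 * (t 3 * t 4 + t 3 * t 6 + t 3 * t 5 + t 4 * t 6 + t 4 * t 5 + t 6 * t 5)
          - (t 3 * t 4 * t 6 + t 3 * t 4 * t 5 + t 3 * t 6 * t 5 + t 4 * t 6 * t 5)))
      * (t 1 + t 2 + t 7 - Y) * ((Y - t 1) * (Y - t 2) * (Y - t 7))
    + (Y - t 0 + (t 3 + t 4 + t 6 + t 5)) * ((Y - t 1) * (Y - t 2) * (Y - t 7)) ^ 2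

/-- The leading coefficient `a₃(t)` of `C` (third Newton difference at `Y = 0,1,2,3` over `6`). Its zero set is the
census's `degenerate-resultant` stratum. -/
def cubicLead (t : Fin 8 → ℝ) : ℝ := (cubicC t 3 - 3 * cubicC t 2 + 3 * cubicC t 1 - cubicC t 0) / 6

/-- The coefficient of `Y²`. -/
def coefA2 (t : Fin 8 → ℝ) : ℝ :=
  (cubicC t 2 - 2 * cubicC t 1 + cubicC t 0) / 2 - (cubicC t 3 - 3 * cubicC t 2 + 3 * cubicC t 1 - cubicC t 0) / 2

/-- The coefficient of `Y`. -/
def coefA1 (t : Fin 8 → ℝ) : ℝ :=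
  (cubicC t 1 - cubicC t 0) - (cubicC t 2 - 2 * cubicC t 1 + cubicC t 0) / 2
    + (cubicC t 3 - 3 * cubicC t 2 + 3 * cubicC t 1 - cubicC t 0) / 3

/-- The constant coefficient. -/
def coefA0 (t : Fin 8 → ℝ) : ℝ := cubicC t 0

/-- **Monomial form**: `C(Y) = a₃Y³ + a₂Y² + a₁Y + a₀` (P2 g23's `cubic_newton`). -/
theorem cubicC_eq_poly (t : Fin 8 → ℝ) (Y : ℝ) :
    cubicC t Y = cubicLead t * Y ^ 3 + coefA2 t * Y ^ 2 + coefA1 t * Y + coefA0 t := by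
  have h := cubic_newton (s := t) (C := cubicC t) (fun _ => rfl) Y
  rw [h]
  simp only [cubicLead, coefA2, coefA1, coefA0]
  ring

/-- **The reversed cubic** `C̃(z) = a₃ + a₂z + a₁z² + a₀z³` (`= z³·C(1/z)` for `z ≠ 0`; a polynomial, so defined and
continuous at `z = 0`, where it equals the leading coefficient `a₃`). -/
def revC (t : Fin 8 → ℝ) (z : ℝ) : ℝ := cubicLead t + coefA2 t * z + coefA1 t * z ^ 2 + coefA0 t * z ^ 3

/-- `C̃(z) = z³·C(1/z)` for `z ≠ 0`. -/
theorem revC_eq (t : Fin 8 → ℝ) {z : ℝ} (hz : z ≠ 0) : revC t z = z ^ 3 * cubicC t z⁻¹ := by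
  rw [cubicC_eq_poly]
  unfold revC
  field_simp

/-- `C̃(0) = a₃`. -/
theorem revC_zero (t : Fin 8 → ℝ) : revC t 0 = cubicLead t := by simp [revC]

/-- `C̃` is continuous. -/
theorem continuous_revC (t : Fin 8 → ℝ) : Continuous (revC t) := by
  unfold revC; fun_prop

/-! ### The checker's cubic polynomial evaluates to `(Q·y_D)⁷·C(y_N/y_D)` -/

section Eval
variable {ε : ℕ → ℝ} {tP : Fin 8 → EPoly} {t : Fin 8 → ℝ} {Q : ℝ}

/-- `cubicAtPoly` is `(Q·y_D)⁷·C(y_N/y_D)` (for `y_D ≠ 0`). -/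
theorem cubicAtPoly_eval {Qn : ℕ} (hQ : (Qn : ℝ) = Q) (ht : ∀ i, EPoly.eval ε (tP i) = Q * t i) (yN : ℤ) {yD : ℕ}
    (hyD : yD ≠ 0) :
    EPoly.eval ε (cubicAtPoly tP Qn yN yD) = (Q * yD) ^ 7 * cubicC t ((yN : ℝ) / yD) := by
  have hyD' : (yD : ℝ) ≠ 0 := by exact_mod_cast hyD
  simp only [cubicAtPoly, facP, facM, facR, prodPoly_eval, List.map, List.prod_cons, List.prod_nil,
    EPoly.eval_merge, EPoly.eval_smul, EPoly.eval_mul, EPoly.eval_const, ht, cubicC, ← hQ]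
  push_cast
  field_simp
  ring

end Eval

/-! ### The sign of `C̃` at an endpoint -/

/-- The box noise vector at `(η₁, η₂) = (0, 0)` is valid (only the box coordinates matter for `cubicAtPoly`). -/
theorem valid_noise00 {D : ℕ} {lo hi : List ℕ} {t : Fin 8 → ℝ} (hok : boxOKc D lo hi = true)
    (h : t ∈ LemmaFBox.box D lo hi) : Valid (noise D lo hi t 0 0) :=
  valid_noise hok h (by simp) (by simp)

/-- **A certified endpoint sign is the sign of `C̃(z_N/z_den)`**: if `endSign … z_N z_den = σ ≠ 0` then
`0 < σ·C̃(z_N/z_den)` at every direction of the box (`t₀ = 1`, `T > 0`, `z_N ≠ 0`, `z_den > 0`). -/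
theorem revC_sign_of_endSign {D T : ℕ} {lo hi : List ℕ} {t : Fin 8 → ℝ} (hok : boxOKc D lo hi = true) (hT : 0 < T)
    (h : t ∈ LemmaFBox.box D lo hi) (ht0 : t 0 = 1) {zN : ℤ} {zden : ℕ} (hzN : zN ≠ 0) (hzden : 0 < zden)
    (hσ : endSign D T lo hi zN zden ≠ 0) :
    0 < (endSign D T lo hi zN zden : ℝ) * revC t ((zN : ℝ) / zden) := by
  -- abstract the checker's integer polynomial FIRST (no tactic below ever sees the concrete term)
  obtain ⟨p, hp⟩ : ∃ p : EPoly,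
      cubicAtPoly (tPoly D T lo hi) (2 * D * T) ((zden : ℤ) * Int.sign zN) zN.natAbs = p := ⟨_, rfl⟩
  have hdef : endSign D T lo hi zN zden = signOfBounds p * Int.sign zN := by rw [endSign, hp]
  rw [hdef] at hσ ⊢
  have hD : 0 < D := by
    have := hok; simp only [boxOKc, decide_eq_true_eq] at this; exact this.1
  have hQpos : (0 : ℝ) < ((2 * D * T : ℕ) : ℝ) := by
    have h2 : (0 : ℕ) < 2 * D * T := Nat.mul_pos (Nat.mul_pos (by norm_num) hD) hT
    exact_mod_cast h2
  have hv : Valid (noise D lo hi t 0 0) := valid_noise00 hok h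
  have htP : ∀ i, EPoly.eval (noise D lo hi t 0 0) (tPoly D T lo hi i) = ((2 * D * T : ℕ) : ℝ) * t i :=
    fun i => tPoly_eval hok ht0 0 0 i
  have hyD : zN.natAbs ≠ 0 := Int.natAbs_ne_zero.mpr hzN
  have heval := cubicAtPoly_eval (ε := noise D lo hi t 0 0) (tP := tPoly D T lo hi) (t := t) rfl htP
    ((zden : ℤ) * Int.sign zN) hyD
  rw [hp] at heval
  clear hp hdef
  have hbounds := EPoly.lower_le_eval hv p
  -- the rational point `(zden·sign zN)/|zN| = zden/zN = (zN/zden)⁻¹`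
  have hzN' : (zN : ℝ) ≠ 0 := by exact_mod_cast hzN
  have hzden' : (0 : ℝ) < zden := by exact_mod_cast hzden
  have hpt : (((zden : ℤ) * Int.sign zN : ℤ) : ℝ) / (zN.natAbs : ℕ) = ((zN : ℝ) / zden)⁻¹ := by
    rcases lt_or_gt_of_ne hzN with hneg | hpos
    · have hs : Int.sign zN = -1 := Int.sign_eq_neg_one_of_neg hneg
      have ha : ((zN.natAbs : ℕ) : ℝ) = -zN := by
        rw [Nat.cast_natAbs]; push_cast; rw [abs_of_neg (by exact_mod_cast hneg)]
      rw [hs, ha]; push_cast; field_simp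
    · have hs : Int.sign zN = 1 := Int.sign_eq_one_of_pos hpos
      have ha : ((zN.natAbs : ℕ) : ℝ) = zN := by
        rw [Nat.cast_natAbs]; push_cast; rw [abs_of_pos (by exact_mod_cast hpos)]
      rw [hs, ha]; push_cast; field_simp
  rw [hpt] at heval
  -- `revC z = z³·C(z⁻¹)`
  have hz : (zN : ℝ) / zden ≠ 0 := div_ne_zero hzN' hzden'.ne'
  have hrev := revC_eq t hz
  have hK : (0 : ℝ) < (((2 * D * T : ℕ) : ℝ) * (zN.natAbs : ℕ)) ^ 7 := by
    have hna : (0 : ℝ) < (zN.natAbs : ℕ) := by exact_mod_cast Int.natAbs_pos.mpr hzN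
    exact pow_pos (mul_pos hQpos hna) 7
  -- the certified sign of the integer polynomial
  have hC : (signOfBounds p = 1 → 0 < cubicC t ((zN : ℝ) / zden)⁻¹) ∧
      (signOfBounds p = -1 → cubicC t ((zN : ℝ) / zden)⁻¹ < 0) ∧
      (signOfBounds p = 1 ∨ signOfBounds p = -1 ∨ signOfBounds p = 0) := by
    unfold signOfBounds
    split_ifs with h1 h2
    · refine ⟨fun _ => ?_, fun h => by norm_num at h, Or.inl rfl⟩
      have : (0 : ℝ) < EPoly.eval (noise D lo hi t 0 0) p := lt_of_lt_of_le (by exact_mod_cast h1) hbounds.1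
      rw [heval] at this
      exact pos_of_mul_pos_right this hK.le
    · refine ⟨fun h => by norm_num at h, fun _ => ?_, Or.inr (Or.inl rfl)⟩
      have : EPoly.eval (noise D lo hi t 0 0) p < 0 := lt_of_le_of_lt hbounds.2 (by exact_mod_cast h2)
      rw [heval] at this
      by_contra hc
      push Not at hc
      exact absurd this (not_lt.mpr (mul_nonneg hK.le hc))
    · exact ⟨fun h => by norm_num at h, fun h => by norm_num at h, Or.inr (Or.inr rfl)⟩
  obtain ⟨hpos1, hneg1, hcases⟩ := hC
  rcases lt_or_gt_of_ne hzN with hneg | hpos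
  · have hs : Int.sign zN = -1 := Int.sign_eq_neg_one_of_neg hneg
    rw [hs] at hσ ⊢
    have hzlt : (zN : ℝ) / zden < 0 := div_neg_of_neg_of_pos (by exact_mod_cast hneg) hzden'
    have hz3 : ((zN : ℝ) / zden) ^ 3 < 0 := Odd.pow_neg (Nat.odd_iff.mpr rfl) hzlt
    rcases hcases with h1 | h1 | h1 <;> rw [h1] at hσ ⊢
    · have : revC t ((zN : ℝ) / zden) < 0 := by rw [hrev]; exact mul_neg_of_neg_of_pos hz3 (hpos1 h1)
      push_cast; linarith
    · have : 0 < revC t ((zN : ℝ) / zden) := by rw [hrev]; exact mul_pos_of_neg_of_neg hz3 (hneg1 h1)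
      push_cast; linarith
    · simp at hσ
  · have hs : Int.sign zN = 1 := Int.sign_eq_one_of_pos hpos
    rw [hs] at hσ ⊢
    have hzgt : 0 < (zN : ℝ) / zden := div_pos (by exact_mod_cast hpos) hzden'
    have hz3 : 0 < ((zN : ℝ) / zden) ^ 3 := pow_pos hzgt 3
    rcases hcases with h1 | h1 | h1 <;> rw [h1] at hσ ⊢
    · have : 0 < revC t ((zN : ℝ) / zden) := by rw [hrev]; exact mul_pos hz3 (hpos1 h1)
      push_cast; linarith
    · have : revC t ((zN : ℝ) / zden) < 0 := by rw [hrev]; exact mul_neg_of_pos_of_neg hz3 (hneg1 h1)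
      push_cast; linarith
    · simp at hσ

/-- **A zero of `C̃` strictly between the endpoints** when the certified endpoint signs are opposite (IVT). -/
theorem exists_revC_zero {D T : ℕ} {lo hi : List ℕ} {t : Fin 8 → ℝ} (hok : boxOKc D lo hi = true) (hT : 0 < T)
    (h : t ∈ LemmaFBox.box D lo hi) (ht0 : t 0 = 1) {fd : FarData} (hzden : 0 < fd.zden) (hlt : fd.zlo < fd.zhi)
    (hzlo : fd.zlo ≠ 0) (hzhi : fd.zhi ≠ 0)
    (hsg : endSign D T lo hi fd.zlo fd.zden * endSign D T lo hi fd.zhi fd.zden = -1) :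
    ∃ z₁ ∈ Ioo ((fd.zlo : ℝ) / fd.zden) ((fd.zhi : ℝ) / fd.zden), revC t z₁ = 0 := by
  have hne1 : endSign D T lo hi fd.zlo fd.zden ≠ 0 := fun h0 => by rw [h0] at hsg; simp at hsg
  have hne2 : endSign D T lo hi fd.zhi fd.zden ≠ 0 := fun h0 => by rw [h0] at hsg; simp at hsg
  have h1 := revC_sign_of_endSign hok hT h ht0 hzlo hzden hne1
  have h2 := revC_sign_of_endSign hok hT h ht0 hzhi hzden hne2
  have hab : (fd.zlo : ℝ) / fd.zden < (fd.zhi : ℝ) / fd.zden :=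
    div_lt_div_of_pos_right (by exact_mod_cast hlt) (by exact_mod_cast hzden)
  have hcont : ContinuousOn (revC t) (Icc ((fd.zlo : ℝ) / fd.zden) ((fd.zhi : ℝ) / fd.zden)) :=
    (continuous_revC t).continuousOn
  have hsg' : (endSign D T lo hi fd.zlo fd.zden : ℝ) * (endSign D T lo hi fd.zhi fd.zden : ℝ) = -1 := by
    exact_mod_cast hsg
  -- the product of the two values is negative
  have hprod : revC t ((fd.zlo : ℝ) / fd.zden) * revC t ((fd.zhi : ℝ) / fd.zden) < 0 := by
    have := mul_pos h1 h2
    have e : (endSign D T lo hi fd.zlo fd.zden : ℝ) * revC t ((fd.zlo : ℝ) / fd.zden) *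
        ((endSign D T lo hi fd.zhi fd.zden : ℝ) * revC t ((fd.zhi : ℝ) / fd.zden))
        = -(revC t ((fd.zlo : ℝ) / fd.zden) * revC t ((fd.zhi : ℝ) / fd.zden)) := by
      linear_combination (revC t ((fd.zlo : ℝ) / fd.zden) * revC t ((fd.zhi : ℝ) / fd.zden)) * hsg'
    linarith
  rcases lt_or_gt_of_ne (mul_ne_zero_iff.mp hprod.ne).1 with hlo | hlo
  · -- revC(z⁻) < 0 < revC(z⁺)
    have hhi : 0 < revC t ((fd.zhi : ℝ) / fd.zden) := by
      by_contra hc; push Not at hc; exact absurd hprod (not_lt.mpr (mul_nonneg_of_nonpos_of_nonpos hlo.le hc))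
    obtain ⟨z₁, hz₁, hz₁0⟩ := intermediate_value_Ioo hab.le hcont ⟨hlo, hhi⟩
    exact ⟨z₁, hz₁, hz₁0⟩
  · have hhi : revC t ((fd.zhi : ℝ) / fd.zden) < 0 := by
      by_contra hc; push Not at hc; exact absurd hprod (not_lt.mpr (mul_nonneg hlo.le hc))
    obtain ⟨z₁, hz₁, hz₁0⟩ := intermediate_value_Ioo' hab.le hcont ⟨hhi, hlo⟩
    exact ⟨z₁, hz₁, hz₁0⟩

/-! ### On the stratum `{a₃ = 0}` the direction is not `Regular` -/

/-- With `a₃ = 0` the cubic is the quadratic `a₂Y² + a₁Y + a₀`, non-zero on the open box (`C(t₁) < 0`), so it has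
at most two roots. -/
theorem roots_ncard_le_two_of_cubicLead_eq_zero {t : Fin 8 → ℝ} (hopen : ∀ j : Fin 7, 0 < t j.succ ∧ t j.succ < t 0)
    (h3 : cubicLead t = 0) : {Y | cubicC t Y = 0}.Finite ∧ {Y | cubicC t Y = 0}.ncard ≤ 2 := by
  classical
  set p : Polynomial ℝ := Polynomial.C (coefA2 t) * Polynomial.X ^ 2 + Polynomial.C (coefA1 t) * Polynomial.X
    + Polynomial.C (coefA0 t) with hp
  have hev : ∀ Y, p.eval Y = cubicC t Y := fun Y => by
    rw [cubicC_eq_poly, h3, hp]; simp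
  have hneg := cubic_at_s1_neg (s := t) (C := cubicC t) (fun _ => rfl) hopen
  have hp0 : p ≠ 0 := fun h0 => by
    have := hev (t 1); rw [h0, Polynomial.eval_zero] at this; linarith
  have hset : {Y | cubicC t Y = 0} = ↑(p.roots.toFinset) := by
    ext Y
    simp only [Set.mem_setOf_eq, Finset.mem_coe, Multiset.mem_toFinset, Polynomial.mem_roots hp0,
      Polynomial.IsRoot.def, hev]
  rw [hset]
  refine ⟨Finset.finite_toSet _, ?_⟩
  rw [Set.ncard_coe_finset]
  calc p.roots.toFinset.card ≤ Multiset.card p.roots := Multiset.toFinset_card_le _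
    _ ≤ p.natDegree := Polynomial.card_roots' p
    _ ≤ 2 := by rw [hp]; exact Polynomial.natDegree_quadratic_le

/-- **On the degenerate-resultant stratum the direction is NOT `Regular`**: if `a₃(t) = 0` then `aOfS t` has at most
two critical values (open box, `t₆ ≠ t₀`). -/
theorem critVals_ncard_le_two_of_cubicLead_eq_zero {t : Fin 8 → ℝ}
    (hopen : ∀ j : Fin 7, 0 < t j.succ ∧ t j.succ < t 0) (h3 : cubicLead t = 0) :
    (critVals (aOfS t)).Finite ∧ (critVals (aOfS t)).ncard ≤ 2 := by
  have h6 := hopen 5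
  change 0 < t 6 ∧ t 6 < t 0 at h6
  have himg := critVals_aOfS_eq_image (s := t) (P := cubicP t) (Q := cubicQ t) (C := cubicC t)
    (fun _ => rfl) (fun _ => rfl) (fun _ => rfl) h6.2.ne
  obtain ⟨hfin, hle⟩ := roots_ncard_le_two_of_cubicLead_eq_zero hopen h3
  have hsub : {Y | cubicC t Y = 0 ∧ cubicQ t Y ≠ 0 ∧
      ∀ k, critFactors (pR (aOfS t)) (qR (aOfS t)) (t 6 - Y + (t 6 - t 0) * cubicP t Y / cubicQ t Y) (Y + t 6) k ≠ 0}
      ⊆ {Y | cubicC t Y = 0} := fun Y hY => hY.1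
  have hfin' := hfin.subset hsub
  rw [himg]
  refine ⟨hfin'.image _, ?_⟩
  calc _ ≤ _ := Set.ncard_image_le hfin'
    _ ≤ {Y | cubicC t Y = 0}.ncard := Set.ncard_le_ncard hsub hfin
    _ ≤ 2 := hle

/-- **`a₃(t) = 0 ⇒ ¬ Regular (aOfS t)`** (open box). -/
theorem not_regular_of_cubicLead_eq_zero {t : Fin 8 → ℝ} (hopen : ∀ j : Fin 7, 0 < t j.succ ∧ t j.succ < t 0)
    (h3 : cubicLead t = 0) : ¬ Regular (aOfS t) := by
  intro hreg
  have := (critVals_ncard_le_two_of_cubicLead_eq_zero hopen h3).2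
  rw [Regular] at hreg
  omega

/-- **Under `Regular`, a zero `z₁` of `C̃` is non-zero and `Y₁ = 1/z₁` is a root of `C`.** -/
theorem root_of_revC_zero {t : Fin 8 → ℝ} (hopen : ∀ j : Fin 7, 0 < t j.succ ∧ t j.succ < t 0)
    (hreg : Regular (aOfS t)) {z₁ : ℝ} (hz : revC t z₁ = 0) : z₁ ≠ 0 ∧ cubicC t z₁⁻¹ = 0 := by
  have hz1 : z₁ ≠ 0 := by
    rintro rfl
    rw [revC_zero] at hz
    exact not_regular_of_cubicLead_eq_zero hopen hz hreg
  refine ⟨hz1, ?_⟩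
  have := revC_eq t hz1
  rw [hz] at this
  have h3 : z₁ ^ 3 ≠ 0 := pow_ne_zero 3 hz1
  exact (mul_eq_zero.mp this.symm).resolve_left h3

end CritFar

end Summit.KontsevichZagierPeriods.Zeta5Search.Barrier.ConeGamma

end
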